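import Summits.KontsevichZagierPeriods.KontsevichZagierPeriods.Theorems.RootDecompZetaThreeFrontierWordRungTwoP1

/-! # `RootDecompZetaThreeFrontierWordRungTwoP2` — part 2/12 of the mechanical ≤270-line split of `RungTwo.stripped.lean`
(split by the decomp-kz census seat for landing; mathematics unchanged; part 2 continues part 1). -/

noncomputable section

namespace Summit.KontsevichZagierPeriods.RootDecompZetaThreeFrontier.WordLayer
open Set MeasureTheory MvPolynomial
open Literature.NumberTheory.Transcendental
open Summit.KontsevichZagierPeriods.KontsevichZagierPeriods.Theses.RootDecompZetaThreeFrontier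
  (HigherWeightDescent)
open Summit.KontsevichZagierPeriods.KontsevichZagierPeriods.Theses.LinRedNormalForm
  (DihedralNormalForm MzvKernelInKZ HoffmanSpanInKZ HoffmanIndependence)

section Specimens
open Literature.ModelTheory.ExponentialFields (IsSemialgebraic)
open Summit.KontsevichZagierPeriods.KontsevichZagierPeriods.Theorems.RootDecompZetaThreeFrontierSupportCollapse
  (collapse_literal)

/-! (private copy of `strictAnti_fin_one` — its public twin in this chain was privatised under the dedup.landed policy) -/
/-- Auxiliary step `strictAnti_fin_one`. [bookkeeping] -/
private theorem strictAnti_fin_one (y : Fin 1 → ℝ) : StrictAnti y := fun a b hab =>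
  absurd hab (by rw [Subsingleton.elim a b]; exact lt_irrefl _)

/-! (private copy of `mem_simplex_two_iff` — its public twin in this chain was privatised under the dedup.landed policy) -/
/-- Membership in `simplex_two_iff`, unfolded. [bookkeeping] -/
private theorem mem_simplex_two_iff (z : Fin 2 → ℝ) :
    z ∈ KZ.openOrderedSimplex 2 ↔ 0 < z 1 ∧ z 1 < z 0 ∧ z 0 < 1 := by
  constructor
  · rintro ⟨h0, h1, ha⟩
    exact ⟨h0 1, ha (show (0 : Fin 2) < 1 by decide), h1 0⟩
  · rintro ⟨h1, h10, h0⟩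
    refine ⟨Fin.forall_fin_two.mpr ⟨h1.trans h10, h1⟩, Fin.forall_fin_two.mpr ⟨h0, h10.trans h0⟩,
      Fin.strictAnti_iff_succ_lt.mpr (Fin.forall_fin_one.mpr ?_)⟩
    simpa using h10

/-! (private copy of `mem_simplex_one_iff` — its public twin in this chain was privatised under the dedup.landed policy) -/
/-- Membership in `simplex_one_iff`, unfolded. [bookkeeping] -/
private theorem mem_simplex_one_iff (y : Fin 1 → ℝ) : y ∈ KZ.openOrderedSimplex 1 ↔ 0 < y 0 ∧ y 0 < 1 := by
  constructor
  · rintro ⟨h0, h1, -⟩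
    exact ⟨h0 0, h1 0⟩
  · rintro ⟨h0, h1⟩
    refine ⟨fun i => ?_, fun i => ?_, strictAnti_fin_one y⟩
    · rw [Fin.fin_one_eq_zero i]; exact h0
    · rw [Fin.fin_one_eq_zero i]; exact h1

/-- A representation of dimension `0` with a genus-zero datum is a weight-`0` word generator
`[pt, p(∅)]`. -/
theorem of_mem_wordGensLE_zero (x : KZ.IntegralRep 0) (p : MvPolynomial (Fin 0) ℚ)
    (a : Fin 0 → Fin 0 → ℕ) (b c : Fin 0 → ℕ)
    (hd : x.domain = {t | (∀ i, 0 < t i) ∧ (∀ i, t i < 1) ∧ StrictAnti t})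
    (hi : EqOn x.integrand (fun t => MvPolynomial.aeval t p / ((∏ i, t i ^ b i) *
      (∏ i, (1 - t i) ^ c i) * ∏ i, ∏ j, if i < j then (t i - t j) ^ a i j else 1)) x.domain) :
    KZ.of x ∈ wordGensLE 0 := by
  refine ⟨0, fun i => i.elim0, p.coeff 0, x, le_rfl, hd, fun t ht => ?_, rfl⟩
  rw [hi ht]
  have hp : (MvPolynomial.aeval t p : ℝ) = ((p.coeff 0 : ℚ) : ℝ) := by
    conv_lhs => rw [MvPolynomial.eq_C_of_isEmpty p]
    rw [MvPolynomial.aeval_C, eq_ratCast]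
  simp [hp]

/-- **The weight-`0` column of every rung**: a genus-zero representation of any dimension with NO
singular variable (`a = b = c = 0` on and around every index) is congruent to a weight-`0` word generator —
the landed support collapse (`Theorems/…SupportCollapse`, `collapse_literal` with `S = ∅`: every variable is
integrated out inside the calculus). -/
theorem gz_free {k : ℕ} (r : KZ.IntegralRep k) (p : MvPolynomial (Fin k) ℚ)
    (a : Fin k → Fin k → ℕ) (b c : Fin k → ℕ)
    (hfree : ∀ i, b i = 0 ∧ c i = 0 ∧ ∀ j, (i < j → a i j = 0) ∧ (j < i → a j i = 0))
    (hd : r.domain = {t | (∀ i, 0 < t i) ∧ (∀ i, t i < 1) ∧ StrictAnti t})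
    (hi : EqOn r.integrand (fun t => MvPolynomial.aeval t p / ((∏ i, t i ^ b i) *
      (∏ i, (1 - t i) ^ c i) * ∏ i, ∏ j, if i < j then (t i - t j) ^ a i j else 1)) r.domain) :
    ∃ m ∈ wordGensLE 0, KZ.of r - m ∈ KZ.relations := by
  obtain ⟨l, x, p₁, a₁, b₁, c₁, hl, -, hxd, hxi, -, hrel⟩ :=
    collapse_literal r p a b c ∅ (fun i _ => hfree i) hd hi
  obtain rfl : l = 0 := Nat.le_zero.mp (by simpa using hl)
  exact ⟨KZ.of x, of_mem_wordGensLE_zero x p₁ a₁ b₁ c₁ hxd hxi, hrel⟩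

/-! ### 11c  The identity specimens `ζ(3)` and `ζ(2,1)` through `GZNormalFormW 3` -/

/-! ### 11d  `PackagingTwo` PROVED: `[pt, A] + [Δ₂, Q·ω₀ω₁] ≡ [Δ₂, 2A + Q/(t₀(1 − t₁))]`

Three moves: rule 1b splits `[Δ₂, 2A + Q·ω₀ω₁]` into `[Δ₂, 2A] + [Δ₂, Q·ω₀ω₁]`; two rule-3
(Newton–Leibniz) moves integrate the constant out, `[Δ₂, 2A] ≡ [Δ₁, 2A·y] ≡ [pt, A]` (primitives `2A·t₁`
on the band `0 < t₁ < t₀` over `Δ₁`, then `A·y²` on the band `0 < y < 1` over the point).  The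
Newton–Leibniz package of the landed support collapse is `private` there; a verbatim copy follows. -/

/-- `t ↦ Fin.snoc x t` is continuous. [folklore] (verbatim private copy, `Theorems/…SupportCollapse`) -/
private theorem continuous_snoc {N : ℕ} (x : Fin N → ℝ) :
    Continuous fun t : ℝ => (Fin.snoc x t : Fin (N + 1) → ℝ) := by
  refine continuous_pi fun j => ?_
  refine Fin.lastCases ?_ (fun i => ?_) j
  · simpa using continuous_id'
  · simpa using continuous_const

/-- Splitting off the last coordinate, `ℝ^{N+1} ≃ ℝ^N × ℝ`, as a volume-preserving measurable
equivalence with inverse `(x, t) ↦ Fin.snoc x t`. [folklore] (verbatim private copy) -/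
private theorem exists_measurableEquiv_snoc (N : ℕ) :
    ∃ e : (Fin (N + 1) → ℝ) ≃ᵐ (Fin N → ℝ) × ℝ,
      MeasurePreserving e volume ((volume : Measure (Fin N → ℝ)).prod (volume : Measure ℝ)) ∧
      ∀ q, e.symm q = Fin.snoc q.1 q.2 := by
  refine ⟨(MeasurableEquiv.piFinSuccAbove (fun _ => ℝ) (Fin.last N)).trans
    MeasurableEquiv.prodComm, ?_, fun q => ?_⟩
  · refine (volume_preserving_piFinSuccAbove (fun _ => ℝ) (Fin.last N)).trans ?_
    rw [Measure.volume_eq_prod]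
    exact Measure.measurePreserving_swap
  · show (MeasurableEquiv.piFinSuccAbove (fun _ => ℝ) (Fin.last N)).symm (q.2, q.1) = _
    rw [MeasurableEquiv.piFinSuccAbove_symm_apply, Fin.insertNthEquiv_last]
    rfl

/-- **Newton–Leibniz over an open band, packaged.** Let `r` be a representation whose domain is
the open band `{(x, t) | x ∈ τ, a x < t < b x}` over a semialgebraic base `τ` with semialgebraic
`a < b`, and whose integrand agrees there with `f`; let `F`, `f` be semialgebraic on the closed band;
suppose `t ↦ F (x, t)` is continuous on `[a x, b x]` with derivative `f (x, ·)` on `(a x, b x)`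
for `x ∈ τ`. Then `[r] ≡ [τ, F (x, b x) − F (x, a x)]` modulo relations; the base integrand is
absolutely integrable by Fubini and the fundamental theorem of calculus.
[Kontsevich–Zagier 2001, §1.2, rule (3)] [folklore] (verbatim copy of
`Summit.KontsevichZagierPeriods.ArrangementNormalForm.JanusBands.IntegrateOut.newtonLeibniz_pack`) -/
private theorem newtonLeibniz_pack {N : ℕ} {τ : Set (Fin N → ℝ)} (hτ : IsSemialgebraic ℚ τ)
    {a b : (Fin N → ℝ) → ℝ} (ha : IsSemialgebraicFunOn ℚ τ a) (hb : IsSemialgebraicFunOn ℚ τ b)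
    (hab : ∀ x ∈ τ, a x < b x) {f F : (Fin (N + 1) → ℝ) → ℝ}
    (hf : IsSemialgebraicFunOn ℚ (KZlog.band τ a b) f)
    (hF : IsSemialgebraicFunOn ℚ (KZlog.band τ a b) F)
    (hcont : ∀ x ∈ τ, ContinuousOn (fun t => F (Fin.snoc x t)) (Icc (a x) (b x)))
    (hder : ∀ x ∈ τ, ∀ t ∈ Ioo (a x) (b x),
      HasDerivAt (fun s => F (Fin.snoc x s)) (f (Fin.snoc x t)) t)
    (r : KZ.IntegralRep (N + 1))
    (hrd : r.domain = {z | (Fin.init z : Fin N → ℝ) ∈ τ ∧ a (Fin.init z) < z (Fin.last N) ∧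
      z (Fin.last N) < b (Fin.init z)})
    (hri : EqOn r.integrand f r.domain) :
    ∃ r' : KZ.IntegralRep N, r'.domain = τ ∧
      (r'.integrand = fun x => F (Fin.snoc x (b x)) - F (Fin.snoc x (a x))) ∧
      KZ.of r - KZ.of r' ∈ KZ.relations := by
  have hτm : MeasurableSet τ := IsSemialgebraic.measurableSet_holds hτ
  have hBsa : IsSemialgebraic ℚ (KZlog.band τ a b) := KZlog.isSemialgebraic_band ha hb
  have hBm : MeasurableSet (KZlog.band τ a b) := IsSemialgebraic.measurableSet_holds hBsa
  have hsub : r.domain ⊆ KZlog.band τ a b := by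
    rw [hrd]; exact fun z hz => ⟨hz.1, hz.2.1.le, hz.2.2.le⟩
  have hdiff : KZlog.band τ a b \ r.domain ⊆
      {z | (Fin.init z : Fin N → ℝ) ∈ τ ∧ z (Fin.last N) = a (Fin.init z)} ∪
        {z | (Fin.init z : Fin N → ℝ) ∈ τ ∧ z (Fin.last N) = b (Fin.init z)} := by
    rw [hrd]
    rintro z ⟨⟨hzτ, h1, h2⟩, hz⟩
    simp only [mem_setOf_eq, not_and, not_lt] at hz
    rcases h1.lt_or_eq with h1 | h1
    · exact Or.inr ⟨hzτ, le_antisymm h2 (hz hzτ h1)⟩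
    · exact Or.inl ⟨hzτ, h1.symm⟩
  have hnull : volume (KZlog.band τ a b \ r.domain) = 0 :=
    measure_mono_null hdiff (measure_union_null (KZ.volume_graph_eq_zero ha)
      (KZ.volume_graph_eq_zero hb))
  have hfO : IntegrableOn f r.domain :=
    r.integrableOn.congr_fun hri (KZ.IntegralRep.measurableSet_domain_holds r)
  have hfB : IntegrableOn f (KZlog.band τ a b) := by
    rw [← Set.union_sdiff_cancel hsub]
    exact integrableOn_union.mpr ⟨hfO, IntegrableOn.of_measure_zero hnull⟩
  let r₂ : KZ.IntegralRep (N + 1) := ⟨KZlog.band τ a b, f, hBsa, hf, hfB⟩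
  have h12 : KZ.of r - KZ.of r₂ ∈ KZ.relations := by
    refine KZ.of_sub_of_mem_relations_of_null r r₂ ?_ hnull fun z hz => hri hz.1
    rw [Set.sdiff_eq_empty.mpr hsub, measure_empty]
  -- the base integrand and its semialgebraicity
  have hmap : ∀ {c : (Fin N → ℝ) → ℝ}, IsSemialgebraicFunOn ℚ τ c →
      (∀ x ∈ τ, c x ∈ Icc (a x) (b x)) →
      IsSemialgebraicFunOn ℚ τ (fun x => F (Fin.snoc x (c x))) := by
    intro c hc hcm
    have hφ : IsSemialgebraicMapOn ℚ τ (fun x => (Fin.snoc x (c x) : Fin (N + 1) → ℝ)) := by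
      refine IsSemialgebraicMapOn.of_forall hτ fun j => ?_
      refine Fin.lastCases ?_ (fun i => ?_) j
      · simpa using hc
      · simpa using isSemialgebraicFunOn_apply hτ i
    exact IsSemialgebraicFunOn.comp_isSemialgebraicMapOn_holds hF hφ
      fun x hx => KZlog.snoc_mem_band.mpr ⟨hx, hcm x hx⟩
  have hgsa : IsSemialgebraicFunOn ℚ τ (fun x => F (Fin.snoc x (b x)) - F (Fin.snoc x (a x))) :=
    IsSemialgebraicFunOn.sub_holds (hmap hb fun x hx => Set.right_mem_Icc.mpr (hab x hx).le)
      (hmap ha fun x hx => Set.left_mem_Icc.mpr (hab x hx).le)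
  -- integrability of the base integrand: Fubini and the fundamental theorem of calculus
  set G : (Fin (N + 1) → ℝ) → ℝ := (KZlog.band τ a b).indicator f with hG_def
  have hG : Integrable G := (integrable_indicator_iff hBm).mpr hfB
  obtain ⟨e, he, he_symm⟩ := exists_measurableEquiv_snoc N
  have hG2 : Integrable (fun q : (Fin N → ℝ) × ℝ => G (Fin.snoc q.1 q.2))
      ((volume : Measure (Fin N → ℝ)).prod (volume : Measure ℝ)) := by
    have h := ((he.symm e).integrable_comp_emb e.symm.measurableEmbedding (g := G)).mpr hG
    convert h using 1
    ext q
    simp [he_symm]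
  have hfib_in : ∀ x ∈ τ, (fun t => G (Fin.snoc x t)) =
      (Icc (a x) (b x)).indicator (fun t => f (Fin.snoc x t)) := by
    intro x hx
    ext t
    by_cases ht : t ∈ Icc (a x) (b x)
    · rw [indicator_of_mem ht, hG_def, indicator_of_mem (KZlog.snoc_mem_band.mpr ⟨hx, ht⟩)]
    · rw [indicator_of_notMem ht, hG_def,
        indicator_of_notMem (fun h => ht (KZlog.snoc_mem_band.mp h).2)]
  have hgx : ∀ x ∈ τ, Integrable (fun t => G (Fin.snoc x t)) →
      F (Fin.snoc x (b x)) - F (Fin.snoc x (a x)) = ∫ t, G (Fin.snoc x t) := by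
    intro x hx hxi
    rw [hfib_in x hx, integral_indicator measurableSet_Icc, integral_Icc_eq_integral_Ioc,
      ← intervalIntegral.integral_of_le (hab x hx).le]
    refine (intervalIntegral.integral_eq_sub_of_hasDerivAt_of_le (hab x hx).le (hcont x hx)
      (hder x hx) ?_).symm
    rw [intervalIntegrable_iff_integrableOn_Icc_of_le (hab x hx).le]
    have h' := hxi
    rw [hfib_in x hx] at h'
    exact (integrable_indicator_iff measurableSet_Icc).mp h'
  have hgi : IntegrableOn (fun x => F (Fin.snoc x (b x)) - F (Fin.snoc x (a x))) τ := by
    refine Integrable.mono' hG2.integral_norm_prod_left.integrableOn.integrable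
      (KZ.aestronglyMeasurable_of_isSemialgebraicFunOn hgsa hτm) ?_
    rw [ae_restrict_iff' hτm]
    filter_upwards [hG2.prod_right_ae] with x hx hxτ
    rw [hgx x hxτ hx]
    exact norm_integral_le_integral_norm _
  let r' : KZ.IntegralRep N :=
    ⟨τ, fun x => F (Fin.snoc x (b x)) - F (Fin.snoc x (a x)), hτ, hgsa, hgi⟩
  have h23 : KZ.of r₂ - KZ.of r' ∈ KZ.relations :=
    KZ.newtonLeibnizRel_subset_relations ⟨N, r₂, r', a, b, F, hF, ha, hb,
      fun x hx => (hab x hx).le, rfl, hcont, hder, fun x _ => rfl, rfl⟩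
  refine ⟨r', rfl, rfl, ?_⟩
  have : KZ.of r - KZ.of r' = (KZ.of r - KZ.of r₂) + (KZ.of r₂ - KZ.of r') := by abel
  rw [this]
  exact KZ.relations.add_mem h12 h23

/-- `Δ₂` is the band `0 < t₁ < t₀` over `Δ₁` -/
private theorem openOrderedSimplex_two_eq_band : KZ.openOrderedSimplex 2 =
    {z : Fin 2 → ℝ | (Fin.init z : Fin 1 → ℝ) ∈ KZ.openOrderedSimplex 1 ∧ (0 : ℝ) < z (Fin.last 1) ∧
      z (Fin.last 1) < (Fin.init z : Fin 1 → ℝ) (Fin.last 0)} := by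
  ext z
  rw [mem_simplex_two_iff]
  simp only [mem_setOf_eq, mem_simplex_one_iff]
  rw [show (Fin.init z : Fin 1 → ℝ) 0 = z 0 from rfl, show (Fin.init z : Fin 1 → ℝ) (Fin.last 0) = z 0 from rfl,
    show z (Fin.last 1) = z 1 from rfl]
  constructor
  · rintro ⟨h1, h10, h0⟩; exact ⟨⟨h1.trans h10, h0⟩, h1, h10⟩
  · rintro ⟨⟨-, h0⟩, h1, h10⟩; exact ⟨h1, h10, h0⟩

/-! ### 11e  `WordClosureNFThree` from the two named move facts of weight `≤ 3`

`DivergenceLEThree` — a NON-admissible word of weight `1 ≤ w ≤ 3` (first letter `ω₁` or last letter `ω₀`)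
carries only the coefficient `q = 0` on an (absolutely convergent!) representation: the tree's
`MzvKernelInKZ.Negative.Divergence.eq_zero_of_not_adm` BY NAME (module unbuilt on the farm; the weight-1
/-- Auxiliary step `is`. [bookkeeping] -/
instance is PROVED in §12, `divergence_weight_one`).  `DualityThree` — `[Δ₃, q·ω₀ω₁ω₁] ≡ [Δ₃, q·ω₀ω₀ω₁]`
inside the calculus (ONE change of variables `tᵢ ↦ 1 − t₂₋ᵢ`): the tree's `MzvKernelInKZ.Negative.Duality`
(`cDual3`) BY NAME.  From the two, the closure induction below is bookkeeping (rule 1b). -/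

end Specimens
/-! ## §12  The rung `K = 1` of the weight–dimension ladder, decided in full (gen 9)

`GZNormalFormW 1`: every genus-zero representation of dimension `≤ 1` — an integrable
`P(y) / (y ^ b (1 - y) ^ c)` on `(0,1)` with `P ∈ ℚ[y]` — is congruent inside the KZ calculus to a
weight-`0` word generator `[pt, A]`.  The proof is the first place where the ladder USES integrability
(a field of `KZ.IntegralRep`): an integrable `P(y)/(y^b (1-y)^c)` is a polynomial on `(0,1)` (both poles
must cancel — comparison with `y⁻¹`, `intervalIntegral.integrableOn_Ioo_rpow_iff`), after which ONE
Newton–Leibniz move (the landed support collapse, weight-`0` column `gz_free`) integrates it out.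
The same pole test decides the weight-`1` slice of the divergence move `DivergenceLEThree`
(`divergence_weight_one`: `[Δ₁, q·ω_ε]` exists only with `q = 0`).  Rungs `K = 0, 1` are thus theorems;
`K = 2` (Li₂ / ζ(2) words, two-variable pole cancellation) is the first open rung, `K = 3` is item 28709's
normal form (Brown 2009, `M_{0,6}` analogue). -/

section RungOne
open Literature.ModelTheory.ExponentialFields (IsSemialgebraic)
/-! ### 12a  Pole test and forced divisibility (real analysis on `(0,1)`) -/

end RungOne
end Summit.KontsevichZagierPeriods.RootDecompZetaThreeFrontier.WordLayer
end
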